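import Literature.AlgebraicGeometry.Resolution.PowerSeriesRegularLocal
import Literature.NumberTheory.EllipticCurves.FormalGroupLawPointwiseProofs
import Mathlib.RingTheory.PowerSeries.Derivative
import HarnessLib

/-!
# The invariant derivation `d/ω` of a Weierstrass curve on `R⟦z⟧` and on `R⟦z₁, z₂⟧`

Trunk T-NT-EC (Literature/NumberTheory/EllipticCurves). Definitions (with their immediate API)
used by the formal proof of the Mazur–Tate theta relation (named fact
`WeierstrassCurve.padicSigma_theta_formal`, `CanonicalPAdicHeightThetaProofs.lean`;
Blakestad–Grant 2023, Prop. 14: "`D = d/ω` extends to the invariant derivation on `𝓕` … `D₁`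
denotes `D` acting on `t₁` while treating `t₂` as a constant"):

* `WeierstrassCurve.formalEta W : R⟦X⟧` — the series
  `η(z) = 1 - a₁z - a₂z² - 2a₃w(z) - 2a₄z w(z) - 3a₆w(z)² = 1 - (∂f/∂w)(z, w(z)) ∈ R⟦z⟧`
  (`f(z, w) = z³ + a₁zw + a₂z²w + a₃w² + a₄zw² + a₆w³` the contraction of AEC IV.1.1,
  `w(z) = formalW`), defined over ANY commutative ring (coefficients in `ℤ[a₁,…,a₆]`). It is the
  inverse of the invariant differential: **`ω(z)/dz · η(z) = 1`** (`formalOmega_mul_formalEta`,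
  over `ℚ`-algebras where the tree's `formalOmega = (dx/dz)/(2y + a₁x + a₃)` lives), i.e.
  `ω = dz/(1 - f_w(z, w(z)))` — the residue form `-dz/G_w` of the plane cubic
  `G(z, w) = f(z, w) - w = 0`, which is `dx/(2y + a₁x + a₃)` in the chart `x = z/w`, `y = -1/w`
  (AEC IV.1: `ω(z) = (1 + a₁z + (a₁² + a₂)z² + ⋯)dz ∈ ℤ[a₁,…,a₆]⟦z⟧dz`);
* `WeierstrassCurve.formalInvariantDerivation W : Derivation R R⟦X⟧ R⟦X⟧` —
  `D = d/ω = η · d/dz`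
  (Mazur–Stein–Tate 2006 Thm. 1.3 / Blakestad–Grant 2023 §3: the derivation in which the sigma
  differential equation `x + c = -D(Dσ/σ)` is written);
* `WeierstrassCurve.formalInvariantDerivationMv W i`, a
  `Derivation R (MvPowerSeries τ R) (MvPowerSeries τ R)` — `Dᵢ = η(zᵢ) · ∂/∂zᵢ`, `D` acting on the variable `zᵢ` of `R⟦(z_j)_{j ∈ τ}⟧` with the other
  variables constant (Blakestad–Grant's `D₁`), built on the tree's partial derivative
  `Literature.AlgebraicGeometry.Resolution.MvPowerSeries.pderiv`.

* `Literature.NumberTheory.EllipticCurves.logDeriv₂Num δ f = f·δ(δf) - (δf)²` — the numerator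
  of the second logarithmic derivative along a derivation `δ` (generic), with its additivity
  `logDeriv₂Num_mul` and the Wronskian consequence `deriv_wronskian_mul_eq`.

API: `constantCoeff_formalEta`, `map_formalEta`, `formalOmega_mul_formalEta`,
`formalEta_eq_invOfUnit_formalOmega`, `formalInvariantDerivation_apply/_C/_X`,
`formalInvariantDerivationMv_apply/_C/_X_self/_X_of_ne`,
`logDeriv₂Num_mul/_sq/_const_mul/_mul_ratio`. (The name `invariantDerivation` is taken by the
`(x, y)`-coordinate derivation `d/ω` on `R[x, y]` of `LatticeHomOfCurve.lean`; the objects here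
are its formal-group counterparts in the parameter `z`.)

## Sources

* J. H. Silverman, *The Arithmetic of Elliptic Curves*, 2nd ed. (2009): IV.1 (pp. 115–116:
  `f(z,w)`, `w(z)`, the expansions of `x(z)`, `y(z)` and of the invariant differential
  `ω(z) = dx(z)/(2y(z) + a₁x(z) + a₃) = (1 + a₁z + (a₁² + a₂)z² + ⋯)dz`), IV.4 (invariant
  differentials `P(T)dT`, `P(F(T,S))F_X(T,S) = P(T)`).
* C. Blakestad, D. Grant, J. Number Theory 249 (2023) (arXiv:1903.02480), §3 (the invariant
  derivation `D = d/ω`, `D₁`).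
* B. Mazur, W. Stein, J. Tate, Doc. Math. Extra Vol. Coates (2006), Thm. 1.3 (`d/ω`).

## Design notes

`formalEta` is taken as the primitive object (not `formalOmega⁻¹`) because it is an explicit
polynomial in `z` and `w(z)` with coefficients in `ℤ[a₁,…,a₆]`: the derivations `D`, `D₁` are then
defined over every commutative ring and commute with base change (`map_formalEta`). The identity
`ω · η = 1` is proved from the tree's definition of `formalOmega` by implicit differentiation of
the fixed point (`derivative_formalW`) and Euler's identity for the cubic `f`. Nothing is asserted
without proof; this file introduces no named fact.
-/

noncomputable section

open PowerSeries Literature.NumberTheory.EllipticCurves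
open Literature.AlgebraicGeometry.Resolution (MvPowerSeries.pderiv MvPowerSeries.coeff_pderiv
  MvPowerSeries.pderiv_X)

namespace WeierstrassCurve

variable {R : Type*} [CommRing R] (W : WeierstrassCurve R)

/-! ### `η = 1 - f_w(z, w(z))` -/

/-- **`η(z) = 1 - (∂f/∂w)(z, w(z)) = 1 - a₁z - a₂z² - 2a₃w - 2a₄zw - 3a₆w² ∈ R⟦z⟧`**, the inverse of
the invariant differential `ω(z)/dz` (see `formalOmega_mul_formalEta`); coefficients in
`ℤ[a₁, …, a₆]`. [Silverman AEC IV.1 (`ω(z) ∈ ℤ[a₁,…,a₆]⟦z⟧dz`), IV.4] [cite: SilvermanAEC2009, IV.1.1] -/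
def formalEta : R⟦X⟧ :=
  1 - (C W.a₁ * X + C W.a₂ * X ^ 2 + 2 * C W.a₃ * W.formalW + 2 * C W.a₄ * X * W.formalW +
    3 * C W.a₆ * W.formalW ^ 2)

/-- Unfolding `formalEta`. [folklore] -/
theorem formalEta_def : W.formalEta =
    1 - (C W.a₁ * X + C W.a₂ * X ^ 2 + 2 * C W.a₃ * W.formalW + 2 * C W.a₄ * X * W.formalW +
      3 * C W.a₆ * W.formalW ^ 2) := rfl

/-- `η(0) = 1`. [folklore] -/
@[simp] theorem constantCoeff_formalEta : constantCoeff W.formalEta = 1 := by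
  have hw : constantCoeff W.formalW = 0 := by
    rw [← coeff_zero_eq_constantCoeff_apply]; exact W.coeff_formalW_of_lt_three (by norm_num)
  simp [formalEta, hw]

/-- `η` is a unit of `R⟦z⟧`. [folklore] -/
theorem isUnit_formalEta : IsUnit W.formalEta := by
  rw [PowerSeries.isUnit_iff_constantCoeff, constantCoeff_formalEta]; exact isUnit_one

/-- `η` commutes with base change (its coefficients lie in `ℤ[a₁, …, a₆]`). [folklore] -/
theorem map_formalEta {S : Type*} [CommRing S] (φ : R →+* S) :
    PowerSeries.map φ W.formalEta = (W.map φ).formalEta := by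
  simp only [formalEta, map_sub, map_one, map_add, map_mul, map_pow, map_C, map_X,
    W.map_formalW φ, map_ofNat]
  rfl

/-! ### `ω · η = 1` over a `ℚ`-algebra -/

section RatAlgebra

variable {A : Type*} [CommRing A] [Algebra ℚ A] (V : WeierstrassCurve A)

/-- **`(ω(z)/dz) · η(z) = 1`**: the invariant differential `ω = dx/(2y + a₁x + a₃)` of AEC IV.1,
in the parameter `z`, is `dz/(1 - f_w(z, w(z)))`. Proof: with `B = w/z³`, the tree's
`formalOmega = (2B + zB')/(B(2 - a₁z - a₃z³B))`; implicit differentiation of the fixed point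
`w = f(z, w)` gives `w'(1 - f_w) = f_z`, and Euler's identity `z f_z + w f_w = 3f - a₁zw - a₃w²`
with `f = w` gives `(zw' - w)(1 - f_w) = w(2 - a₁z - a₃w)`, i.e. `(2B + zB')η = B(2 - a₁z - a₃z³B)`.
[Silverman AEC IV.1 (expansion of `ω(z)`), IV.4] [cite: SilvermanAEC2009, IV.1.1] -/
theorem formalOmega_mul_formalEta : V.formalOmega * V.formalEta = 1 := by
  -- `B = w/z³`, `w = z³B`, `w' = 3z²B + z³B'`
  set B := V.formalWDivCube with hB
  have hwB : V.formalW = X ^ 3 * B := V.formalW_eq_X_pow_mul_formalWDivCube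
  have hdw : d⁄dX A (X ^ 3 * B) = 3 * X ^ 2 * B + X ^ 3 * d⁄dX A B := by
    rw [Derivation.leibniz, Derivation.leibniz_pow, derivative_X, smul_eq_mul, smul_eq_mul]
    simp only [nsmul_eq_mul, Nat.cast_ofNat]
    ring
  -- implicit differentiation of the fixed point, and the fixed point, in terms of `B`
  have h1 := V.derivative_formalW
  have h2 := V.formalWStep_formalW
  rw [formalWStep] at h2
  rw [hwB, hdw] at h1
  rw [hwB] at h2
  -- the key identity `(2B + zB')·η = B(2 - a₁z - a₃z³B)` (times `z³`, then cancel)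
  have hkey : (2 * B + X * d⁄dX A B) * V.formalEta = B * (2 - C V.a₁ * X - C V.a₃ * X ^ 3 * B) := by
    have h3 : X ^ 3 * ((2 * B + X * d⁄dX A B) * V.formalEta) =
        X ^ 3 * (B * (2 - C V.a₁ * X - C V.a₃ * X ^ 3 * B)) := by
      rw [formalEta, hwB]
      linear_combination X * h1 + 3 * h2
    ext n
    have := congrArg (coeff (n + 3)) h3
    rwa [coeff_X_pow_mul, coeff_X_pow_mul] at this
  -- `Ω · den = num` from the definition, `den` with constant term `2`
  set den : A⟦X⟧ := B * (2 - C V.a₁ * X - C V.a₃ * X ^ 3 * B) with hden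
  have hB0 : constantCoeff B = 1 := by
    rw [← coeff_zero_eq_constantCoeff_apply, hB, formalWDivCube, coeff_mk, zero_add,
      V.coeff_three_formalW]
  have hden1 : constantCoeff den = ↑(unitTwo (A := A)) := by
    simp only [hden, map_mul, map_sub, hB0, map_ofNat, constantCoeff_C, constantCoeff_X,
      map_pow, mul_zero, sub_zero, one_mul, unitTwo]
    norm_num
  have hΩ : V.formalOmega = (2 * B + X * d⁄dX A B) * PowerSeries.invOfUnit den unitTwo := rfl
  have hinv : den * PowerSeries.invOfUnit den unitTwo = 1 := PowerSeries.mul_invOfUnit den _ hden1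
  calc V.formalOmega * V.formalEta
      = ((2 * B + X * d⁄dX A B) * V.formalEta) * PowerSeries.invOfUnit den unitTwo := by
        rw [hΩ]; ring
    _ = den * PowerSeries.invOfUnit den unitTwo := by rw [hkey]
    _ = 1 := hinv

/-- Hence `η = ω⁻¹`: `formalEta` is the inverse `invOfUnit formalOmega 1`. [folklore] -/
theorem formalEta_eq_invOfUnit_formalOmega :
    V.formalEta = PowerSeries.invOfUnit V.formalOmega 1 := by
  have h1 : V.formalOmega * PowerSeries.invOfUnit V.formalOmega 1 = 1 :=
    PowerSeries.mul_invOfUnit _ _ (by rw [V.constantCoeff_formalOmega, Units.val_one])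
  calc V.formalEta = V.formalEta * (V.formalOmega * PowerSeries.invOfUnit V.formalOmega 1) := by
        rw [h1, mul_one]
    _ = (V.formalOmega * V.formalEta) * PowerSeries.invOfUnit V.formalOmega 1 := by ring
    _ = PowerSeries.invOfUnit V.formalOmega 1 := by rw [formalOmega_mul_formalEta, one_mul]

/-- `η · ω = 1`. [folklore] -/
theorem formalEta_mul_formalOmega : V.formalEta * V.formalOmega = 1 := by
  rw [mul_comm, formalOmega_mul_formalEta]

end RatAlgebra

/-! ### The invariant derivation `D = d/ω = η · d/dz` on `R⟦z⟧` -/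

/-- **The invariant derivation `D = d/ω` of `W` on `R⟦z⟧`**: `D h = η · dh/dz`
(`= (dh/dz)/(ω/dz)` over a `ℚ`-algebra, by `formalOmega_mul_formalEta`). This is the derivation
in which the Mazur–Tate sigma equation reads `x + c = -D(Dσ/σ)`. [Mazur–Stein–Tate 2006, Thm. 1.3
(`d/ω`); Blakestad–Grant 2023, §3 (`D = d/ω`)] [cite: BlakestadGrant2023, §3] -/
def formalInvariantDerivation : Derivation R R⟦X⟧ R⟦X⟧ :=
  W.formalEta • d⁄dX R

/-- `D h = η · h'`. [folklore] -/
theorem formalInvariantDerivation_apply (h : R⟦X⟧) :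
    W.formalInvariantDerivation h = W.formalEta * d⁄dX R h := by
  simp [formalInvariantDerivation]

/-- `D` kills constants. [folklore] -/
@[simp] theorem formalInvariantDerivation_C (r : R) : W.formalInvariantDerivation (C r) = 0 := by
  rw [formalInvariantDerivation_apply, derivative_C, mul_zero]

/-- `D z = η`. [folklore] -/
@[simp] theorem formalInvariantDerivation_X : W.formalInvariantDerivation X = W.formalEta := by
  rw [formalInvariantDerivation_apply, derivative_X, mul_one]

/-! ### The invariant derivation `Dᵢ = η(zᵢ) · ∂/∂zᵢ` on `R⟦(z_j)_j⟧` -/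

section Mv

variable {τ : Type*}

/-- **`Dᵢ = D` acting on the variable `zᵢ`** of `R⟦(z_j)_{j ∈ τ}⟧`, the other variables being
constants: `Dᵢ f = η(zᵢ) · ∂f/∂zᵢ` (Blakestad–Grant's `D₁` on `R⟦t₁, t₂⟧`).
[Blakestad–Grant 2023, §3 ("if `D₁` denotes `D` acting on `t₁` while treating `t₂` as a
constant")] [cite: BlakestadGrant2023, §3] -/
def formalInvariantDerivationMv (i : τ) :
    Derivation R (MvPowerSeries τ R) (MvPowerSeries τ R) :=
  (W.formalEta.subst (MvPowerSeries.X i : MvPowerSeries τ R)) • MvPowerSeries.pderiv i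

/-- `Dᵢ f = η(zᵢ) · ∂f/∂zᵢ`. [folklore] -/
theorem formalInvariantDerivationMv_apply (i : τ) (f : MvPowerSeries τ R) :
    W.formalInvariantDerivationMv i f =
      W.formalEta.subst (MvPowerSeries.X i : MvPowerSeries τ R) * MvPowerSeries.pderiv i f := by
  simp [formalInvariantDerivationMv]

/-- `Dᵢ` kills constants. [folklore] -/
@[simp] theorem formalInvariantDerivationMv_C (i : τ) (r : R) :
    W.formalInvariantDerivationMv i (MvPowerSeries.C r) = 0 := by
  have : (MvPowerSeries.C r : MvPowerSeries τ R) = algebraMap R (MvPowerSeries τ R) r := rfl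
  rw [this, Derivation.map_algebraMap]

/-- `Dᵢ zᵢ = η(zᵢ)`. [folklore] -/
@[simp] theorem formalInvariantDerivationMv_X_self [DecidableEq τ] (i : τ) :
    W.formalInvariantDerivationMv i (MvPowerSeries.X i) =
      W.formalEta.subst (MvPowerSeries.X i : MvPowerSeries τ R) := by
  rw [formalInvariantDerivationMv_apply, MvPowerSeries.pderiv_X, if_pos rfl, mul_one]

/-- `Dᵢ zⱼ = 0` for `j ≠ i`. [folklore] -/
theorem formalInvariantDerivationMv_X_of_ne [DecidableEq τ] {i j : τ} (h : j ≠ i) :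
    W.formalInvariantDerivationMv i (MvPowerSeries.X j) = 0 := by
  rw [formalInvariantDerivationMv_apply, MvPowerSeries.pderiv_X, if_neg h, mul_zero]

end Mv

end WeierstrassCurve

/-! ### The numerator `f·δ²f - (δf)²` of a second logarithmic derivative -/

namespace Literature.NumberTheory.EllipticCurves

variable {S A : Type*} [CommSemiring S] [CommRing A] [Algebra S A]

/-- **`f · δ(δf) - (δf)²`** — the numerator of the second logarithmic derivative
`δ(δf/f) = (f·δ²f - (δf)²)/f²` of `f` along a derivation `δ` (for the sigma function,
`σ²·D(Dσ/σ) = -(x + c)σ²` is the Mazur–Tate equation with poles cleared; Blakestad–Grant's proof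
of the theta relation compares "the second logarithmic derivations in `t₁` of both sides").
[Blakestad–Grant 2023, Prop. 14 (proof); Mazur–Stein–Tate 2006, Thm. 1.3] [folklore] -/
def logDeriv₂Num (δ : Derivation S A A) (f : A) : A :=
  f * δ (δ f) - δ f ^ 2

/-- Unfolding. [folklore] -/
theorem logDeriv₂Num_def (δ : Derivation S A A) (f : A) :
    logDeriv₂Num δ f = f * δ (δ f) - δ f ^ 2 := rfl

/-- **Additivity of the second logarithmic derivative**, poles cleared:
`N(fg) = N(f)·g² + f²·N(g)` (`(log fg)'' = (log f)'' + (log g)''`). [folklore] -/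
theorem logDeriv₂Num_mul (δ : Derivation S A A) (f g : A) :
    logDeriv₂Num δ (f * g) = logDeriv₂Num δ f * g ^ 2 + f ^ 2 * logDeriv₂Num δ g := by
  simp only [logDeriv₂Num, Derivation.leibniz, smul_eq_mul, map_add]
  ring

/-- `N(f²) = 2f²·N(f)`. [folklore] -/
theorem logDeriv₂Num_sq (δ : Derivation S A A) (f : A) :
    logDeriv₂Num δ (f ^ 2) = 2 * f ^ 2 * logDeriv₂Num δ f := by
  rw [sq f, logDeriv₂Num_mul]; ring

/-- A `δ`-constant has `N = 0`. [folklore] -/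
theorem logDeriv₂Num_of_apply_eq_zero (δ : Derivation S A A) {f : A} (h : δ f = 0) :
    logDeriv₂Num δ f = 0 := by
  simp [logDeriv₂Num, h]

/-- Multiplying by a `δ`-constant: `N(κf) = κ²N(f)`. [folklore] -/
theorem logDeriv₂Num_const_mul (δ : Derivation S A A) {κ : A} (h : δ κ = 0) (f : A) :
    logDeriv₂Num δ (κ * f) = κ ^ 2 * logDeriv₂Num δ f := by
  rw [logDeriv₂Num_mul, logDeriv₂Num_of_apply_eq_zero δ h, zero_mul, zero_add]

/-- **"Ratio data" compose**: if `N(f)·d_f = n_f·f²` and `N(g)·d_g = n_g·g²` (i.e.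
`(log f)'' = n_f/d_f`, `(log g)'' = n_g/d_g`), then
`N(fg)·(d_f d_g) = (n_f d_g + n_g d_f)·(fg)²`. [folklore] -/
theorem logDeriv₂Num_mul_ratio (δ : Derivation S A A) {f g nf df ng dg : A}
    (hf : logDeriv₂Num δ f * df = nf * f ^ 2) (hg : logDeriv₂Num δ g * dg = ng * g ^ 2) :
    logDeriv₂Num δ (f * g) * (df * dg) = (nf * dg + ng * df) * (f * g) ^ 2 := by
  rw [logDeriv₂Num_mul]
  linear_combination g ^ 2 * dg * hf + f ^ 2 * df * hg

/-- **Equal second logarithmic derivatives make the Wronskian quotient constant**, poles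
cleared: if `N(f)·g² = N(g)·f²` then `w = f·δg - g·δf` satisfies `δw·(fg) = w·δ(fg)`.
[Blakestad–Grant 2023, Prop. 14 (proof: "so the first logarithmic derivatives of both sides in
`t₁` differ additively by a function `μ(t₂)`")] [folklore] -/
theorem deriv_wronskian_mul_eq (δ : Derivation S A A) {f g : A}
    (h : logDeriv₂Num δ f * g ^ 2 = logDeriv₂Num δ g * f ^ 2) :
    δ (f * δ g - g * δ f) * (f * g) = (f * δ g - g * δ f) * δ (f * g) := by
  simp only [logDeriv₂Num] at h
  simp only [Derivation.leibniz, smul_eq_mul, map_sub]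
  linear_combination -h

end Literature.NumberTheory.EllipticCurves
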